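import Mathlib
import Literature.Analysis.FluidPDE.StationaryEulerPotentials

/-!
# Cheapest-falsifier run for card `pressureless-cone-bernoulli-momentum`: the trace identity, PROVED.
-/

noncomputable section

open scoped InnerProductSpace RealInnerProductSpace

namespace Summit.AnomalousDissipation.AnomalousDissipation.Cruxes.PointFluxCone.SketchProofs

open Literature.Analysis.FluidPDE Literature.Analysis.FluidPDE.StationaryEuler

variable {d : Type*} [Fintype d] [DecidableEq d]

omit [DecidableEq d] in
/-- Row contraction of the stress tensor `Φ` on its `(i, j)` diagonal:
`Σ_m Φ_{mkml} = (tr S̄ η_k η_l + S̄_{kl} |η|²)/|η|⁴`. -/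
theorem sum_Φ_diag (c : WaveCert d) (k l : d) :
    ∑ m, c.Φ m k m l = (c.S.trace * c.η k * c.η l + c.S k l * ‖c.η‖ ^ 2) / (‖c.η‖ ^ 2) ^ 2 := by
  unfold WaveCert.Φ
  rw [← Finset.sum_div]
  congr 1
  have h1 : ∑ m, c.S k m * c.η m * c.η l = (∑ m, c.S k m * c.η m) * c.η l := by
    rw [Finset.sum_mul]
  have h2 : ∑ m, c.S m l * c.η k * c.η m = c.η k * ∑ m, c.η m * c.S m l := by
    rw [Finset.mul_sum]; exact Finset.sum_congr rfl fun m _ => by ring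
  have h3 : ∑ m, c.S k l * c.η m * c.η m = c.S k l * ∑ m, c.η m ^ 2 := by
    rw [Finset.mul_sum]; exact Finset.sum_congr rfl fun m _ => by ring
  have h4 : ∑ m, c.S m m * c.η k * c.η l = c.S.trace * c.η k * c.η l := by
    rw [Matrix.trace, Finset.sum_mul, Finset.sum_mul]; rfl
  simp only [Finset.sum_add_distrib, Finset.sum_sub_distrib, h1, h2, h3, h4, c.sum_S_η, c.sum_η_S,
    c.sum_η_sq]
  ring

/-- **PressurelessTrace, proved**: for a trace-free certificate, `tr S[φ] = (S̄ : ∇²φ)/|η|²`. -/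
theorem pressurelessTrace (c : WaveCert d) (htr : c.S.trace = 0) (φ : Ed d → ℝ) (x : Ed d) :
    ∑ m, c.strS φ m m x = (∑ k, ∑ l, c.S k l * pd (eb k) (pd (eb l) φ) x) / ‖c.η‖ ^ 2 := by
  unfold WaveCert.strS
  rw [Finset.sum_comm]
  rw [Finset.sum_div]
  refine Finset.sum_congr rfl fun k _ => ?_
  rw [Finset.sum_comm, Finset.sum_div]
  refine Finset.sum_congr rfl fun l _ => ?_
  rw [← Finset.sum_mul, sum_Φ_diag, htr]
  have hη : (‖c.η‖ ^ 2) ≠ 0 := ne_of_gt c.normSq_pos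
  rw [zero_mul, zero_mul, zero_add, sq (‖c.η‖ ^ 2), mul_div_mul_right _ _ hη]
  ring

end Summit.AnomalousDissipation.AnomalousDissipation.Cruxes.PointFluxCone.SketchProofs

end
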